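import Summits.BirchSwinnertonDyer.BirchSwinnertonDyer.Theorems.PrintCf2SplitBadTwoAvatarValuesTwo
import Summits.BirchSwinnertonDyer.BirchSwinnertonDyer.Theorems.PrintCf2SplitBadTwoGalConjInfinityType
import HarnessLib

/-!
# The v10 triple for every frame of road α, granted only Deuring's theorem with generators
# (capstone of the B11–B11d / O2′–O2″ chain; cell `bsd-print-cf2`, seat `bsd-line-cf2-p1-w4` g7)

Crux `stmt-BirchSwinnertonDyer-20368` `PrintCf2.SplitBadTwoRankOneOfFacts`, road α (v9.1 of record; v10
sketch).  Theses-free; `--supports` the crux.  `QuadraticPart.exists_v10_triple_of_frame`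
(`…AvatarValuesTwo`) produced, for every frame (member `W` with `C • W = cm7^{(d)}`, `K` imaginary
quadratic with `2 = v v̄` split, `c ≠ 1`, `ψ` of type `(1,0)` pinned to `W`) and every generator pair of
the `ℤ₂²`-tower, the data `(θ̂, θ, θK, ρ := θK·λ, r)` with `θK * θK = 1`, `IsPAdicAvatarOf ι ρ r`,
`FactorsThroughPair κ₁ κ₂ r`, `θK⁻¹ * ρ = λ = (ψ∘c)⁻¹`, `θ² = 1`, `KellerYin2024.IsHeckeCharOf ι θ θK` and
exact ramification — under two hypotheses: the print `Deuring_exists_heckeCharacter_of_maximalCM_withGenerators`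
and `λ.IsAlgebraic`.  `…GalConjInfinityType` proved the latter
(`isAlgebraic_galConj_inv_of_isImaginaryQuadratic`); THIS FILE records the composite
**`exists_v10_triple_of_frame_of_print`**, whose only hypothesis beyond the frame binders is the cited
print (a tree NAMED FACT implying the S0′ conjunct `Deuring_exists_heckeCharacter_of_maximalCM`).

HONEST FRAMING: CONDITIONAL on that print; closes nothing; beyond-print theorem: no.  BSD is not proved
by any of this.

References: [SilvermanATAEC1994] Ch. II Thm. 9.2, Thm. 10.5; [deShalit1987] II.4.17 (54).
-/

-- the summit namespace `Summit.BirchSwinnertonDyer.BirchSwinnertonDyer` repeats the problem name by design (D-0017)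
set_option linter.dupNamespace false
set_option autoImplicit false

noncomputable section

open scoped Classical

open Polynomial NumberField IsDedekindDomain Field Filter WeierstrassCurve
  Literature.NumberTheory.EllipticCurves Literature.NumberTheory.GaloisRepresentations
  Literature.NumberTheory.EllipticCurves.Rank1Residual
  Literature.NumberTheory.EllipticCurves.KellerYin2024

namespace Summit.BirchSwinnertonDyer.BirchSwinnertonDyer.Theorems.PrintCf2.QuadraticPart

variable {K : Type} [Field K] [NumberField K] {d : ℤ} {W : WeierstrassCurve ℚ} [W.IsElliptic]
  [W.IsGloballyMinimal] {C : VariableChange ℚ} {v vbar : HeightOneSpectrum (𝓞 K)} {ψ : HeckeCharacter K}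

/-- **The v10 triple for every frame of road α, granted Deuring's theorem with generators.**  For every
member `W` (`C • W = cm7^{(d)}`, `d ≠ 0`), every imaginary quadratic `K` with `2 = v v̄` split, every
`ι : ℚ̄₂ ≃ ℂ`, `c ≠ 1`, `ψ` of type `(1,0)` with `L(ψ, s) = L(W, s)`, every `S`, and EVERY generator pair
of the `ℤ₂²`-tower: there are the sign `θ̂` of the (`ℤ₂ˣ`-valued) avatar of `λ := (ψ∘c)⁻¹`, S3a's framed
`θ : Γ_K →ₜ* GL₁(𝓞_{ℚ₂(S)})` with `θ² = 1`, a Hecke character `θK` of finite order with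
`KellerYin2024.IsHeckeCharOf ι θ θK`, exact ramification and `θK * θK = 1`, `ρ := θK * λ` and a framed
`r : Γ_K →ₜ* GL₁(ℚ̄₂)` with `IsPAdicAvatarOf ι ρ r` and `FactorsThroughPair κ₁ κ₂ r`.
[cite: SilvermanATAEC1994, Ch. II Thm. 9.2 and Thm. 10.5 (b)] [cite: deShalit1987, II.4.17 (54)] -/
theorem exists_v10_triple_of_frame_of_print
    (hDe : Deuring_exists_heckeCharacter_of_maximalCM_withGenerators)
    (hd0 : d ≠ 0) (hC : C • W = cm7.quadraticTwist (d : ℚ)) (hK : IsImaginaryQuadratic K)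
    (hv : ((2 : ℕ) : 𝓞 K) ∈ v.asIdeal) (hvbar : ((2 : ℕ) : 𝓞 K) ∈ vbar.asIdeal) (hne : vbar ≠ v)
    (ι : PadicAlgCl 2 ≃+* ℂ) (c : K ≃ₐ[ℚ] K) (hc : c ≠ 1)
    (hψ : ψ.HasInfinityType (fun _ ↦ 1) (fun _ ↦ 0))
    (hpin : ∀ s : ℂ, 3 / 2 < s.re → heckeLFunction ψ s = W.LSeries s) (S : Set (PadicAlgCl 2)) :
    ∃ (θs : absoluteGaloisGroup K →ₜ* ℤ_[2]ˣ) (θ : FramedGaloisRep K (padicCoeffIntegers S) 1)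
      (θK ρ : HeckeCharacter K) (r : FramedGaloisRep K (PadicAlgCl 2) 1),
      (∀ σ, θs σ = 1 ∨ θs σ = -1) ∧ (∀ σ, θ σ ^ 2 = 1) ∧ (∀ σ, θ σ = 1 ↔ θs σ = 1) ∧
      θK.IsFiniteOrder ∧ IsHeckeCharOf ι θ θK ∧
      (∀ w : HeightOneSpectrum (𝓞 K), θK.IsUnramifiedAt w ↔ θ.IsUnramifiedAt w) ∧
      θK * θK = 1 ∧ ρ = θK * (HeckeCharacter.galConj c ψ)⁻¹ ∧
      θK⁻¹ * ρ = (HeckeCharacter.galConj c ψ)⁻¹ ∧ IsPAdicAvatarOf ι ρ r ∧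
      ∀ {κ₁ κ₂ : ZpExtension K 2} {γ₁ γ₂ : absoluteGaloisGroup K},
        ZpExtension.IsTopGeneratorPair κ₁ κ₂ γ₁ γ₂ → FactorsThroughPair κ₁ κ₂ r :=
  exists_v10_triple_of_frame hDe hd0 hC hK hv hvbar hne ι c hc hψ hpin
    (isAlgebraic_galConj_inv_of_isImaginaryQuadratic hK c hc hψ) S

end Summit.BirchSwinnertonDyer.BirchSwinnertonDyer.Theorems.PrintCf2.QuadraticPart

end
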